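/-
Copyright (c) 2026 the pub-hodgecm-mathlib formalisation cell (harness21).  Prover seat hodgecm-mathlib-K2Liu-p05 (g4), 2026-09-04
(Track B «K2-LIT», crux hLiu418 = stmt-HodgeConjecture-24832, socket #42F′, ROAD I v3, organ G2-Weil, bridge (G2-W4) part W4-ii (derivative):
the EXPLICIT derivative of the Siegel–Weil section along `U(2,2)` at a real place).
-/
import Summits.HodgeConjecture.HodgeConjecture.Theorems.K2LiuSwSectionPlaceSmooth           -- ★ p858607 (W4-ii assembly)
import Summits.HodgeConjecture.HodgeConjecture.Theorems.K2LiuArchSectionPlacePinned        -- (W4-ii χ-pinning): `archSectionRepJ_placeSecJ_inl_tensorPi`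
import Summits.HodgeConjecture.HodgeConjecture.Theorems.K2LiuWeilDatumLieDerivativeU22     -- ★ p858313 (G2-W2 along every `X`): `hasDerivAt_weilDatum_expMem_smul'`
import Literature.RepresentationTheory.KonnoKonno2007.JunctionWeilDatumGeneralRank         -- ★ `isArchWeilDatum_weilRepPair`, `weilRepPair_κ_hermitePi_zero`
import HarnessLib

/-!
# (G2-W4-ii, derivative) `d∕ds|₀ f_{a ⊗ f}(h · placeSecJ σ (exp (sY), 1)) = f_{(η′_Y • a + 𝒥⁻¹((dω_Y Φ₁) ⊠ Φ₂)) ⊗ f}(h)` — THE EXPLICIT SECTION IDENTITY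

Track B ∕ K2-LIT, hLiu418 = stmt-HodgeConjecture-24832, #42F′ ROAD I v3 organ G2-Weil, bridge (G2-W4) (LEAD F0P6-plan (g12) RULING M-156j (3) «W4-ii
`K2LiuSwSectionArchOrbitDeriv` ⇒ `hasDerivAt_swSection_arch_orbit`»; HANDOFF v26 deal «p05 (g4) item (2): χ-pinning ⇒ the explicit `hasDerivAt … 0`»; SIGS v3.17 §G2 (b)
«the section identity `d∕dt|₀ (swSection Φ)(h exp tX) = swSection (ω(X)Φ) h`»).  Namespace `Summit.HodgeConjecture.HodgeConjecture.Cruxes.HLiu418.K2LiuSwSectionArchOrbit`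
(continued).  THEOREMS ONLY (no definition, no instance, no notation, no named fact, no `sorry`); the Mathlib idiom `attribute [local instance 100]
LieRing.ofAssociativeRing` (as ★ `RealMatrixGroups`, (G2-W2)) to name the Lie algebra `(uFormGroup (Fin 2) (Fin 2)).lie`; `--supports stmt-HodgeConjecture-24832 --as helper`.

INPUTS BY NAME: (W4-ii assembly) ★ `exists_clm_swSection_tmul_mul_archEmb_placeSecJ` (`f_{a ⊗ f}(h · placeSecJ σ u) = η_t(placeSecJ σ u) · ℓ′(archSectionRepJ σ (placeSecJ σ u) (𝒥 a))`),
★ `contDiffAt_swSection_tmul_placeSecJ`; (χ-pinning) `archSectionRepJ_placeSecJ_inl_tensorPi` (`archSectionRepJ σ (placeSecJ σ (g,1)) (Φ₁ ⊠ Φ₂) = (weilRepPair (g,1) Φ₁) ⊠ Φ₂`, NO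
twist); (G2-W2) ★ `hasDerivAt_weilDatum_expMem_smul'` at the hypothesis-free junction datum `weilRepPair = weilRep ∘ toBig` of `U(2,2) × U(1,0)` (★
`isArchWeilDatum_weilRepPair`, vacuum clause ★ `weilRepPair_κ_hermitePi_zero` = KK Lemma 5.2, exponents `(0, −1, −2, −2)`).
* §1 **`contDiffAt_swSection_tmul_placeSecJ_expMem`** — for `Y ∈ 𝔲(2,2)` and `a` with `𝒥 a = Φ₁ ⊠ Φ₂`, `s ↦ f_{a ⊗ f}(h · placeSecJ σ (exp (sY), 1))` is `C^∞` (★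
  `RealMatrixGroup.contDiffAt_coe_expMem_mk`); **`contDiffAt_coe_etaD_placeSecJ_expMem`** — so is the character factor `s ↦ η_t(placeSecJ σ (exp (sY), 1))`.
* §2 **`hasDerivAt_swSection_tmul_placeSecJ_expMem`** — THE SECTION IDENTITY with an EXPLICIT derivative vector in `𝓢(X_∞)`:
  `HasDerivAt (s ↦ swSection sD (a ⊗ f) (h · placeSecJ σ (exp (sY), 1))) (swSection sD (a′ ⊗ f) h) 0`,
  **`a′ = η′_Y • a + 𝒥⁻¹ ((dω_Y Φ₁) ⊠ Φ₂)`**, `η′_Y = deriv (s ↦ η_t(placeSecJ σ (exp (sY), 1))) 0` (a scalar: the `det`-power character ★ `etaD t` along the curve) and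
  `dω_Y Φ₁ = ∑ᵢ aᵢ(Y) • κOp (kᵢ,1) (Gᵢ (κOp (kᵢ⁻¹,1) Φ₁))` the (G2-W2) letter sum at `ω = weilRepPair` (`aᵢ(Y)` the coordinates of `Y` in ★ `u22AdaptedBasis`) —
  product rule on `η(s) · ℓ′((weilRepPair (exp (sY), 1) Φ₁) ⊠ Φ₂)`, then `f_{a′ ⊗ f}(h) = ℓ′(𝒥 a′)` read back through ★ `exists_clm_swSection_tmul_mul_archEmb_placeSecJ` at `u = 1`.
NOT here (sequel, (A1)∕G1 glue): the curve identity `archEmb (placeSecJ σ (exp (sY), 1)) = archExp hX s` for the block letter `X ∈ archSkew` of `Y` at `σ` (★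
`K2LiuArchSkewPlaces.exists_archSkew_single`), which turns §2 into G1-END's `hXφ` for Siegel–Weil sections BY NAME; the closed form `η′_Y = ((t_{w(σ)}+1)∕2) · tr Y`.

HONEST LABEL: HC_CM is proved only modulo the 7 printed citations (2 remaining named inputs: hLiu418 = stmt-HodgeConjecture-24832, h413 =
stmt-HodgeConjecture-24833) until rung 0 closes; organ capital for #42F′'s Road I, moves no counter.

## References
[Folland1989] G. B. Folland, *Harmonic Analysis in Phase Space* (1989), Prop. (1.43), §4.2 (4.23)–(4.24), Prop. (4.39) · [Varadarajan1984] V. S. Varadarajan,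
*Lie Groups, Lie Algebras, and Their Representations* (1984), Thm. 2.10.1, (2.10.19), Thm. 2.11.2 · [KudlaRallis1994] S. Kudla, S. Rallis, Ann. of Math. 140
(1994), §1 · [GelbartRogawski1991] Invent. Math. 105 (1991), §3.1 Prop. 3.1.1 · [KonnoKonno2007] Kyushu J. Math. 61 (2007), §3.3, Lemma 5.2 · [Paul1998] §1.2.
-/

set_option autoImplicit false
set_option linter.dupNamespace false

noncomputable section

open scoped Classical Matrix TensorProduct SchwartzMap MatrixGroups Matrix.Norms.Operator
open NumberField NumberField.InfinitePlace NumberField.mixedEmbedding IsDedekindDomain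
open Literature.Analysis.SegalBargmann Literature.Analysis.Distribution
open Literature.RepresentationTheory.HeisenbergGroup
open Literature.NumberTheory.Automorphic Literature.NumberTheory.Automorphic.UnitaryGroup
open Literature.NumberTheory.Weil1964 Literature.NumberTheory.Weil1964.MpS Literature.NumberTheory.Weil1964.UnitaryWeil
open Literature.RepresentationTheory.HarrisKudlaSweet1996 Literature.NumberTheory.GaloisRepresentations
open Literature.NumberTheory.GelbartRogawski1991 Literature.NumberTheory.GelbartRogawski1991.UnitaryDualPair
open Literature.NumberTheory.GelbartRogawski1991.UnitaryDualPair.LocalSplitting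
open Literature.NumberTheory.GelbartRogawski1991.GRConstruction
open Literature.NumberTheory.K2Lit.SiegelDoubled
open Literature.RepresentationTheory.KonnoKonno2007 hiding LetterKind letterOf letterGen letterOf_boost letterOf_torus letterOf_torus_eq
  letterGen_boost letterGen_torus letterGen_mem_lie exp_smul_letterGen
open Literature.RepresentationTheory.KonnoKonno2007.RealDualPair
open Summit.HodgeConjecture.HodgeConjecture.Cruxes.HLiu418.K2LiuArchSectionPlaceBlock
open Summit.HodgeConjecture.HodgeConjecture.Cruxes.HLiu418.K2LiuU22AdaptedBasis
open Summit.HodgeConjecture.HodgeConjecture.Cruxes.HLiu418.K2LiuWeilDatumSmoothU22 (hasDerivAt_weilDatum_expMem_smul')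
open Summit.HodgeConjecture.HodgeConjecture.Cruxes.HLiu418 (K2LiuArchOneParameterOrbitDefs.archEmb)

-- Mathlib idiom (`Mathlib/Algebra/Lie/OfAssociative.lean`), as in ★ `RealMatrixGroups` ∕ (G2-W2): the commutator bracket on `Matrix n n ℂ`, needed to name the
-- Lie algebra `(uFormGroup (Fin 2) (Fin 2)).lie` of `U(2,2)`
attribute [local instance 100] LieRing.ofAssociativeRing

-- the doubled metaplectic carrier `Mp(𝕎^𝔻)ᶜᵒⁿᵗ` and the CM sign frame elaborate slowly (cf. ★ `K2LiuSwSectionArchOrbitSmooth`)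
set_option maxHeartbeats 2000000

namespace Summit.HodgeConjecture.HodgeConjecture.Cruxes.HLiu418.K2LiuSwSectionArchOrbit

variable (L : Type) [Field L] [NumberField L] [IsCMField L]

variable {N M n : ℕ} (e : Fin N × Fin M ≃ Fin n)
  (dV : Fin N → L) (hdV : ∀ i, IsCMField.complexConj L (dV i) = dV i) (hdV0 : ∀ i, dV i ≠ 0)
  (dW : Fin M → L) (hdW : ∀ i, IsCMField.complexConj L (dW i) = dW i) (hdW0 : ∀ i, dW i ≠ 0)
  (σ : {v : InfinitePlace (Fp L) // v.IsReal})
  (e₂P : PosIdx (signVec (cmPlaceOver L)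
      (fun k => Sum.elim (cmGramEntry L e dV hdV dW hdW) (-cmGramEntry L e dV hdV dW hdW) ((LocalSplitting.e₂ n).symm k)) (imagUnit L) σ) ≃ Fin 2)
  (e₂Q : NegIdx (signVec (cmPlaceOver L)
      (fun k => Sum.elim (cmGramEntry L e dV hdV dW hdW) (-cmGramEntry L e dV hdV dW hdW) ((LocalSplitting.e₂ n).symm k)) (imagUnit L) σ) ≃ Fin 2)

/-! ## §1 Smoothness along the one-parameter curves `s ↦ placeSecJ σ (exp (sY), 1)` -/

/-- the curve `s ↦ exp (sY)` of `U(2,2)` is matrix-smooth (★ `RealMatrixGroup.contDiffAt_coe_expMem_mk` along the linear map `s ↦ s • Y`).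
[cite: Varadarajan1984, Thm. 2.10.1] -/
theorem contDiffAt_coe_expMem_smul (Y : ↥(uFormGroup (Fin 2) (Fin 2)).lie.toSubmodule) (t₀ : ℝ) :
    ContDiffAt ℝ ((⊤ : ℕ∞) : WithTop ℕ∞)
      (fun s : ℝ => ((((uFormGroup (Fin 2) (Fin 2)).expMem
        ⟨((s • Y : ↥(uFormGroup (Fin 2) (Fin 2)).lie.toSubmodule) : Matrix (Fin 2 ⊕ Fin 2) (Fin 2 ⊕ Fin 2) ℂ), (s • Y).2⟩ :
          UForm (Fin 2) (Fin 2)) : GL (Fin 2 ⊕ Fin 2) ℂ) : Matrix (Fin 2 ⊕ Fin 2) (Fin 2 ⊕ Fin 2) ℂ)) t₀ := by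
  have hexp := (uFormGroup (Fin 2) (Fin 2)).contDiffAt_coe_expMem_mk (t₀ • Y)
  have hlin : ContDiffAt ℝ ((⊤ : ℕ∞) : WithTop ℕ∞) (fun s : ℝ => s • Y) t₀ := (contDiff_id.smul contDiff_const).contDiffAt
  exact ContDiffAt.comp (g := fun Z : ↥(uFormGroup (Fin 2) (Fin 2)).lie.toSubmodule =>
      ((((uFormGroup (Fin 2) (Fin 2)).expMem ⟨(Z : Matrix (Fin 2 ⊕ Fin 2) (Fin 2 ⊕ Fin 2) ℂ), Z.2⟩ : UForm (Fin 2) (Fin 2)) :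
        GL (Fin 2 ⊕ Fin 2) ℂ) : Matrix (Fin 2 ⊕ Fin 2) (Fin 2 ⊕ Fin 2) ℂ))
    (f := fun s : ℝ => s • Y) t₀ hexp hlin

/-- `exp (0 · Y) = 1` in `U(2,2)`. [folklore] -/
theorem expMem_zero_smul (Y : ↥(uFormGroup (Fin 2) (Fin 2)).lie.toSubmodule) :
    ((uFormGroup (Fin 2) (Fin 2)).expMem
        ⟨(((0 : ℝ) • Y : ↥(uFormGroup (Fin 2) (Fin 2)).lie.toSubmodule) : Matrix (Fin 2 ⊕ Fin 2) (Fin 2 ⊕ Fin 2) ℂ), ((0 : ℝ) • Y).2⟩ :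
      UForm (Fin 2) (Fin 2)) = 1 := by
  refine Subtype.ext (Units.ext ?_)
  change NormedSpace.exp ((((0 : ℝ) • Y : ↥(uFormGroup (Fin 2) (Fin 2)).lie.toSubmodule)) : Matrix (Fin 2 ⊕ Fin 2) (Fin 2 ⊕ Fin 2) ℂ) = 1
  rw [zero_smul, Submodule.coe_zero, NormedSpace.exp_zero]

include hdV0 hdW0 in
/-- **the character factor `s ↦ η_t(placeSecJ σ (exp (sY), 1))` is `C^∞`** (★ `contDiffAt_character_inl` — É. Cartan — at the continuous character
`η_t ∘ placeSecJ σ`, ★ `continuous_coe_etaD_placeSecJ`). [cite: Varadarajan1984, Thm. 2.11.2] [cite: Paul1998, §1.2 (1.2.2)] -/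
theorem contDiffAt_coe_etaD_placeSecJ_expMem (t : InfinitePlace L → ℤ) (Y : ↥(uFormGroup (Fin 2) (Fin 2)).lie.toSubmodule) (t₀ : ℝ) :
    ContDiffAt ℝ ((⊤ : ℕ∞) : WithTop ℕ∞)
      (fun s : ℝ => ((etaD L e dV hdV dW hdW t
        (placeSecJ L (IsCMField.complexConj L) (n + n) (IsCMField.complexConj_ne_one L) (cmPlaceOver L) (cmPlaceOver_smul L) _
            (gramD_gram_realDiagonal_entry_ne_zero L e dV hdV dW hdW hdV0 hdW0) (complexConj_imagUnit L) (imagUnit_ne_zero L) σ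
            (cmPlaceOver_comap L) (gramD_eq_diagonal_cm L e dV hdV dW hdW) (J := hermD L e dV hdV dW hdW) rfl
            (complexConj_smul_infinitePlace L) e₂P e₂Q
            ((((uFormGroup (Fin 2) (Fin 2)).expMem
                ⟨((s • Y : ↥(uFormGroup (Fin 2) (Fin 2)).lie.toSubmodule) : Matrix (Fin 2 ⊕ Fin 2) (Fin 2 ⊕ Fin 2) ℂ), (s • Y).2⟩ :
                UForm (Fin 2) (Fin 2)), (1 : UForm Unit Empty)) : Ginf (Fin 2) (Fin 2) Unit Empty)) : ℂˣ) : ℂ)) t₀ :=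
  K2LiuWeilDatumSmoothU22.contDiffAt_character_inl
    (χ := (Units.coeHom ℂ).comp ((etaD L e dV hdV dW hdW t).comp
      (placeSecJ L (IsCMField.complexConj L) (n + n) (IsCMField.complexConj_ne_one L) (cmPlaceOver L) (cmPlaceOver_smul L) _
            (gramD_gram_realDiagonal_entry_ne_zero L e dV hdV dW hdW hdV0 hdW0) (complexConj_imagUnit L) (imagUnit_ne_zero L) σ
            (cmPlaceOver_comap L) (gramD_eq_diagonal_cm L e dV hdV dW hdW) (J := hermD L e dV hdV dW hdW) rfl
            (complexConj_smul_infinitePlace L) e₂P e₂Q)))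
    (continuous_coe_etaD_placeSecJ L e dV hdV hdV0 dW hdW hdW0 σ e₂P e₂Q t) (contDiffAt_coe_expMem_smul Y t₀)

/-- **the one-parameter case of ★ `contDiffAt_swSection_tmul_placeSecJ`**: for `Y ∈ 𝔲(2,2)` and `a` with `𝒥 a = Φ₁ ⊠ Φ₂`,
`s ↦ swSection sD (a ⊗ f) (h · placeSecJ σ (exp (sY), 1))` is `C^∞` at every `t₀`. [cite: Varadarajan1984, Thm. 2.10.1] [cite: Folland1989, §4.2 (4.24), Prop. (4.39)] -/
theorem contDiffAt_swSection_tmul_placeSecJ_expMem {χ : HeckeCharacter L} (hχu : χ.IsUnitary) (hχs : IsSplittingChar L 1 χ)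
    {sD : HA L e dV hdV dW hdW →* MpD L e dV hdV dW hdW} (hsD : IsDoubledWeilRep L e dV hdV hdV0 dW hdW hdW0 χ sD)
    {t : InfinitePlace L → ℤ} (ht : χ.HasUnitaryArchType t 0) (hodd : ∀ w, Odd (t w)) (h : HA L e dV hdV dW hdW)
    (f : FinSB (Fp L) (Fin (n + n))) (Y : ↥(uFormGroup (Fin 2) (Fin 2)).lie.toSubmodule)
    (Φ₁ : 𝓢((DPIdx (Fin 2) (Fin 2) Unit Empty → ℝ), ℂ)) (Φ₂ : 𝓢(((Fin (n + n) × {v : {v : InfinitePlace (Fp L) // v.IsReal} // v ≠ σ}) → ℝ), ℂ))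
    {a : 𝓢((Fin (n + n) → mixedSpace (Fp L)), ℂ)}
    (ha : ((((schwartzTransport
                  (scaledFrame (Fp L) (Fin (n + n))
                    (placeScale (n + n) fun v => sqrtAbs (signVec (cmPlaceOver L)
                      (fun k => Sum.elim (cmGramEntry L e dV hdV dW hdW) (-cmGramEntry L e dV hdV dW hdW) ((LocalSplitting.e₂ n).symm k))
                      (imagUnit L) v))
                    (placeScale_ne_zero (n + n) (sqrtAbs_signVec_ne_zero (IsCMField.complexConj_ne_one L) (cmPlaceOver_smul L)
                      (complexConj_imagUnit L) (imagUnit_ne_zero L) (gramD_gram_realDiagonal_entry_ne_zero L e dV hdV dW hdW hdV0 hdW0))))).trans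
                (schwartzTransport (reindexCLE (placeSplitEquiv (signSplit (signVec (cmPlaceOver L)
                      (fun k => Sum.elim (cmGramEntry L e dV hdV dW hdW) (-cmGramEntry L e dV hdV dW hdW) ((LocalSplitting.e₂ n).symm k))
                      (imagUnit L) σ)) σ)))).trans
                (schwartzTransport (reindexCLE (Equiv.sumCongr
                  (unitJunctionIdx (PosIdx (signVec (cmPlaceOver L)
                      (fun k => Sum.elim (cmGramEntry L e dV hdV dW hdW) (-cmGramEntry L e dV hdV dW hdW) ((LocalSplitting.e₂ n).symm k))
                      (imagUnit L) σ)) (NegIdx (signVec (cmPlaceOver L)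
                      (fun k => Sum.elim (cmGramEntry L e dV hdV dW hdW) (-cmGramEntry L e dV hdV dW hdW) ((LocalSplitting.e₂ n).symm k))
                      (imagUnit L) σ))).symm
                  (Equiv.refl (Fin (n + n) × {v : {v : InfinitePlace (Fp L) // v.IsReal} // v ≠ σ})))))).trans
                (schwartzTransport (reindexCLE (Equiv.sumCongr
                  (dpIdxCongr (PosIdx (signVec (cmPlaceOver L)
                      (fun k => Sum.elim (cmGramEntry L e dV hdV dW hdW) (-cmGramEntry L e dV hdV dW hdW) ((LocalSplitting.e₂ n).symm k))
                      (imagUnit L) σ)) (NegIdx (signVec (cmPlaceOver L)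
                      (fun k => Sum.elim (cmGramEntry L e dV hdV dW hdW) (-cmGramEntry L e dV hdV dW hdW) ((LocalSplitting.e₂ n).symm k))
                      (imagUnit L) σ))
                    Unit Empty (Fin 2) (Fin 2) Unit Empty e₂P e₂Q (Equiv.refl Unit) (Equiv.refl Empty)).symm
                  (Equiv.refl (Fin (n + n) × {v : {v : InfinitePlace (Fp L) // v.IsReal} // v ≠ σ})))))) a = tensorPi Φ₁ Φ₂) (t₀ : ℝ) :
    ContDiffAt ℝ ((⊤ : ℕ∞) : WithTop ℕ∞)
      (fun s : ℝ => swSection L e dV hdV hdV0 dW hdW hdW0 sD (piSchwartzBruhatEquiv (Fp L) (Fin (n + n)) (a ⊗ₜ f))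
        (h * K2LiuArchOneParameterOrbitDefs.archEmb (Fp L) L (IsCMField.complexConj L) (n + n) (hermD L e dV hdV dW hdW)
          (placeSecJ L (IsCMField.complexConj L) (n + n) (IsCMField.complexConj_ne_one L) (cmPlaceOver L) (cmPlaceOver_smul L) _
            (gramD_gram_realDiagonal_entry_ne_zero L e dV hdV dW hdW hdV0 hdW0) (complexConj_imagUnit L) (imagUnit_ne_zero L) σ
            (cmPlaceOver_comap L) (gramD_eq_diagonal_cm L e dV hdV dW hdW) (J := hermD L e dV hdV dW hdW) rfl
            (complexConj_smul_infinitePlace L) e₂P e₂Q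
            ((((uFormGroup (Fin 2) (Fin 2)).expMem
                ⟨((s • Y : ↥(uFormGroup (Fin 2) (Fin 2)).lie.toSubmodule) : Matrix (Fin 2 ⊕ Fin 2) (Fin 2 ⊕ Fin 2) ℂ), (s • Y).2⟩ :
                UForm (Fin 2) (Fin 2)), (1 : UForm Unit Empty)) : Ginf (Fin 2) (Fin 2) Unit Empty)))) t₀ :=
  contDiffAt_swSection_tmul_placeSecJ L e dV hdV hdV0 dW hdW hdW0 σ e₂P e₂Q hχu hχs hsD ht hodd h f (contDiffAt_coe_expMem_smul Y t₀) Φ₁ Φ₂ ha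

/-! ## §2 The explicit derivative at `s = 0` -/

/-- **THE SECTION IDENTITY ALONG `U(2,2)` AT A REAL PLACE, EXPLICIT.**  Let `sD` be ANY `χ`-normalised doubled Weil representation (`χ` unitary, `χ|_{𝕀_{L⁺}} = ε`,
odd unitary archimedean type `(t, 0)`), `h ∈ H(𝔸)`, `f ∈ 𝒮(X_f)`, `σ` a real place with sign types `≃ Fin 2`, `Y ∈ 𝔲(2,2)`, and `a ∈ 𝓢(X_∞)` with `𝒥 a = Φ₁ ⊠ Φ₂`.  Then
`HasDerivAt (s ↦ swSection sD (a ⊗ f) (h · placeSecJ σ (exp (sY), 1))) (swSection sD (a′ ⊗ f) h) 0` with the EXPLICIT archimedean vector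
`a′ = η′_Y • a + 𝒥⁻¹ ((dω_Y Φ₁) ⊠ Φ₂)`, where `η′_Y = deriv (s ↦ η_t(placeSecJ σ (exp (sY), 1))) 0` and `dω_Y Φ₁ = ∑ᵢ aᵢ(Y) • dωᵢ Φ₁` is the (G2-W2) letter sum for the
hypothesis-free junction datum `weilRepPair` — i.e. `X·f_Φ = f_{ω(X)Φ}` for `Φ = a ⊗ f` along the letter of `Y` at `σ`, with `ω(X)` computed (product rule on
`η · ℓ′((weilRepPair (exp (sY),1) Φ₁) ⊠ Φ₂)` from ★ `exists_clm_swSection_tmul_mul_archEmb_placeSecJ` + `archSectionRepJ_placeSecJ_inl_tensorPi`, ★ `hasDerivAt_weilDatum_expMem_smul'`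
at ★ `isArchWeilDatum_weilRepPair` ∕ ★ `weilRepPair_κ_hermitePi_zero`, and the same functional read at `u = 1`). [cite: KudlaRallis1994, §1] [cite: Folland1989, §4.2 (4.24), Prop. (4.39)]
[cite: Varadarajan1984, Thm. 2.10.1 and (2.10.19)] [cite: KonnoKonno2007, §3.3, Lemma 5.2] [cite: GelbartRogawski1991, §3.1 Prop. 3.1.1 p. 455] -/
theorem hasDerivAt_swSection_tmul_placeSecJ_expMem {χ : HeckeCharacter L} (hχu : χ.IsUnitary) (hχs : IsSplittingChar L 1 χ)
    {sD : HA L e dV hdV dW hdW →* MpD L e dV hdV dW hdW} (hsD : IsDoubledWeilRep L e dV hdV hdV0 dW hdW hdW0 χ sD)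
    {t : InfinitePlace L → ℤ} (ht : χ.HasUnitaryArchType t 0) (hodd : ∀ w, Odd (t w)) (h : HA L e dV hdV dW hdW)
    (f : FinSB (Fp L) (Fin (n + n))) (Y : ↥(uFormGroup (Fin 2) (Fin 2)).lie.toSubmodule)
    (Φ₁ : 𝓢((DPIdx (Fin 2) (Fin 2) Unit Empty → ℝ), ℂ)) (Φ₂ : 𝓢(((Fin (n + n) × {v : {v : InfinitePlace (Fp L) // v.IsReal} // v ≠ σ}) → ℝ), ℂ))
    {a : 𝓢((Fin (n + n) → mixedSpace (Fp L)), ℂ)}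
    (ha : ((((schwartzTransport
                  (scaledFrame (Fp L) (Fin (n + n))
                    (placeScale (n + n) fun v => sqrtAbs (signVec (cmPlaceOver L)
                      (fun k => Sum.elim (cmGramEntry L e dV hdV dW hdW) (-cmGramEntry L e dV hdV dW hdW) ((LocalSplitting.e₂ n).symm k))
                      (imagUnit L) v))
                    (placeScale_ne_zero (n + n) (sqrtAbs_signVec_ne_zero (IsCMField.complexConj_ne_one L) (cmPlaceOver_smul L)
                      (complexConj_imagUnit L) (imagUnit_ne_zero L) (gramD_gram_realDiagonal_entry_ne_zero L e dV hdV dW hdW hdV0 hdW0))))).trans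
                (schwartzTransport (reindexCLE (placeSplitEquiv (signSplit (signVec (cmPlaceOver L)
                      (fun k => Sum.elim (cmGramEntry L e dV hdV dW hdW) (-cmGramEntry L e dV hdV dW hdW) ((LocalSplitting.e₂ n).symm k))
                      (imagUnit L) σ)) σ)))).trans
                (schwartzTransport (reindexCLE (Equiv.sumCongr
                  (unitJunctionIdx (PosIdx (signVec (cmPlaceOver L)
                      (fun k => Sum.elim (cmGramEntry L e dV hdV dW hdW) (-cmGramEntry L e dV hdV dW hdW) ((LocalSplitting.e₂ n).symm k))
                      (imagUnit L) σ)) (NegIdx (signVec (cmPlaceOver L)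
                      (fun k => Sum.elim (cmGramEntry L e dV hdV dW hdW) (-cmGramEntry L e dV hdV dW hdW) ((LocalSplitting.e₂ n).symm k))
                      (imagUnit L) σ))).symm
                  (Equiv.refl (Fin (n + n) × {v : {v : InfinitePlace (Fp L) // v.IsReal} // v ≠ σ})))))).trans
                (schwartzTransport (reindexCLE (Equiv.sumCongr
                  (dpIdxCongr (PosIdx (signVec (cmPlaceOver L)
                      (fun k => Sum.elim (cmGramEntry L e dV hdV dW hdW) (-cmGramEntry L e dV hdV dW hdW) ((LocalSplitting.e₂ n).symm k))
                      (imagUnit L) σ)) (NegIdx (signVec (cmPlaceOver L)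
                      (fun k => Sum.elim (cmGramEntry L e dV hdV dW hdW) (-cmGramEntry L e dV hdV dW hdW) ((LocalSplitting.e₂ n).symm k))
                      (imagUnit L) σ))
                    Unit Empty (Fin 2) (Fin 2) Unit Empty e₂P e₂Q (Equiv.refl Unit) (Equiv.refl Empty)).symm
                  (Equiv.refl (Fin (n + n) × {v : {v : InfinitePlace (Fp L) // v.IsReal} // v ≠ σ})))))) a = tensorPi Φ₁ Φ₂) :
    HasDerivAt
      (fun s : ℝ => swSection L e dV hdV hdV0 dW hdW hdW0 sD (piSchwartzBruhatEquiv (Fp L) (Fin (n + n)) (a ⊗ₜ f))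
        (h * K2LiuArchOneParameterOrbitDefs.archEmb (Fp L) L (IsCMField.complexConj L) (n + n) (hermD L e dV hdV dW hdW)
          (placeSecJ L (IsCMField.complexConj L) (n + n) (IsCMField.complexConj_ne_one L) (cmPlaceOver L) (cmPlaceOver_smul L) _
            (gramD_gram_realDiagonal_entry_ne_zero L e dV hdV dW hdW hdV0 hdW0) (complexConj_imagUnit L) (imagUnit_ne_zero L) σ
            (cmPlaceOver_comap L) (gramD_eq_diagonal_cm L e dV hdV dW hdW) (J := hermD L e dV hdV dW hdW) rfl
            (complexConj_smul_infinitePlace L) e₂P e₂Q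
            ((((uFormGroup (Fin 2) (Fin 2)).expMem
                ⟨((s • Y : ↥(uFormGroup (Fin 2) (Fin 2)).lie.toSubmodule) : Matrix (Fin 2 ⊕ Fin 2) (Fin 2 ⊕ Fin 2) ℂ), (s • Y).2⟩ :
                UForm (Fin 2) (Fin 2)), (1 : UForm Unit Empty)) : Ginf (Fin 2) (Fin 2) Unit Empty))))
      (swSection L e dV hdV hdV0 dW hdW hdW0 sD (piSchwartzBruhatEquiv (Fp L) (Fin (n + n))
        ((deriv (fun s : ℝ => ((etaD L e dV hdV dW hdW t
            (placeSecJ L (IsCMField.complexConj L) (n + n) (IsCMField.complexConj_ne_one L) (cmPlaceOver L) (cmPlaceOver_smul L) _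
            (gramD_gram_realDiagonal_entry_ne_zero L e dV hdV dW hdW hdV0 hdW0) (complexConj_imagUnit L) (imagUnit_ne_zero L) σ
            (cmPlaceOver_comap L) (gramD_eq_diagonal_cm L e dV hdV dW hdW) (J := hermD L e dV hdV dW hdW) rfl
            (complexConj_smul_infinitePlace L) e₂P e₂Q
            ((((uFormGroup (Fin 2) (Fin 2)).expMem
                ⟨((s • Y : ↥(uFormGroup (Fin 2) (Fin 2)).lie.toSubmodule) : Matrix (Fin 2 ⊕ Fin 2) (Fin 2 ⊕ Fin 2) ℂ), (s • Y).2⟩ :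
                UForm (Fin 2) (Fin 2)), (1 : UForm Unit Empty)) : Ginf (Fin 2) (Fin 2) Unit Empty)) : ℂˣ) : ℂ)) 0 • a +
          ((((schwartzTransport
                  (scaledFrame (Fp L) (Fin (n + n))
                    (placeScale (n + n) fun v => sqrtAbs (signVec (cmPlaceOver L)
                      (fun k => Sum.elim (cmGramEntry L e dV hdV dW hdW) (-cmGramEntry L e dV hdV dW hdW) ((LocalSplitting.e₂ n).symm k))
                      (imagUnit L) v))
                    (placeScale_ne_zero (n + n) (sqrtAbs_signVec_ne_zero (IsCMField.complexConj_ne_one L) (cmPlaceOver_smul L)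
                      (complexConj_imagUnit L) (imagUnit_ne_zero L) (gramD_gram_realDiagonal_entry_ne_zero L e dV hdV dW hdW hdV0 hdW0))))).trans
                (schwartzTransport (reindexCLE (placeSplitEquiv (signSplit (signVec (cmPlaceOver L)
                      (fun k => Sum.elim (cmGramEntry L e dV hdV dW hdW) (-cmGramEntry L e dV hdV dW hdW) ((LocalSplitting.e₂ n).symm k))
                      (imagUnit L) σ)) σ)))).trans
                (schwartzTransport (reindexCLE (Equiv.sumCongr
                  (unitJunctionIdx (PosIdx (signVec (cmPlaceOver L)
                      (fun k => Sum.elim (cmGramEntry L e dV hdV dW hdW) (-cmGramEntry L e dV hdV dW hdW) ((LocalSplitting.e₂ n).symm k))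
                      (imagUnit L) σ)) (NegIdx (signVec (cmPlaceOver L)
                      (fun k => Sum.elim (cmGramEntry L e dV hdV dW hdW) (-cmGramEntry L e dV hdV dW hdW) ((LocalSplitting.e₂ n).symm k))
                      (imagUnit L) σ))).symm
                  (Equiv.refl (Fin (n + n) × {v : {v : InfinitePlace (Fp L) // v.IsReal} // v ≠ σ})))))).trans
                (schwartzTransport (reindexCLE (Equiv.sumCongr
                  (dpIdxCongr (PosIdx (signVec (cmPlaceOver L)
                      (fun k => Sum.elim (cmGramEntry L e dV hdV dW hdW) (-cmGramEntry L e dV hdV dW hdW) ((LocalSplitting.e₂ n).symm k))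
                      (imagUnit L) σ)) (NegIdx (signVec (cmPlaceOver L)
                      (fun k => Sum.elim (cmGramEntry L e dV hdV dW hdW) (-cmGramEntry L e dV hdV dW hdW) ((LocalSplitting.e₂ n).symm k))
                      (imagUnit L) σ))
                    Unit Empty (Fin 2) (Fin 2) Unit Empty e₂P e₂Q (Equiv.refl Unit) (Equiv.refl Empty)).symm
                  (Equiv.refl (Fin (n + n) × {v : {v : InfinitePlace (Fp L) // v.IsReal} // v ≠ σ})))))).symm
            (tensorPi (∑ i, (((u22AdaptedBasis.repr Y) i : ℝ) : ℂ) •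
              (K2LiuWeilDatumSmoothU22.u22LetterOp Unit Empty (⟨-(Fintype.card Empty : ℤ), -(Fintype.card Unit : ℤ), -(Fintype.card (Fin 2) : ℤ), -(Fintype.card (Fin 2) : ℤ)⟩ : VacExponents) (u22FrameK i) (u22Kind i)).pre
                ((K2LiuWeilDatumSmoothU22.u22LetterOp Unit Empty (⟨-(Fintype.card Empty : ℤ), -(Fintype.card Unit : ℤ), -(Fintype.card (Fin 2) : ℤ), -(Fintype.card (Fin 2) : ℤ)⟩ : VacExponents) (u22FrameK i) (u22Kind i)).gen
                  ((K2LiuWeilDatumSmoothU22.u22LetterOp Unit Empty (⟨-(Fintype.card Empty : ℤ), -(Fintype.card Unit : ℤ), -(Fintype.card (Fin 2) : ℤ), -(Fintype.card (Fin 2) : ℤ)⟩ : VacExponents) (u22FrameK i) (u22Kind i)).post Φ₁))) Φ₂)) ⊗ₜ f)) h) 0 := by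
  obtain ⟨ℓ', hℓ'⟩ := exists_clm_swSection_tmul_mul_archEmb_placeSecJ L e dV hdV hdV0 dW hdW hdW0 σ e₂P e₂Q hχu hχs hsD ht hodd h f
  -- the curve `s ↦ k(s) = (exp (sY), 1)`, with `k(0) = 1`
  have hk0 : ((((uFormGroup (Fin 2) (Fin 2)).expMem
                ⟨(((0 : ℝ) • Y : ↥(uFormGroup (Fin 2) (Fin 2)).lie.toSubmodule) : Matrix (Fin 2 ⊕ Fin 2) (Fin 2 ⊕ Fin 2) ℂ), ((0 : ℝ) • Y).2⟩ :
                UForm (Fin 2) (Fin 2)), (1 : UForm Unit Empty)) : Ginf (Fin 2) (Fin 2) Unit Empty) = 1 := by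
    rw [expMem_zero_smul]; rfl
  -- (1) the character leg: `η(s) = η_t(placeSecJ σ k(s))`, differentiable at `0`, `η(0) = 1`
  have hη : HasDerivAt (fun s : ℝ => ((etaD L e dV hdV dW hdW t
            (placeSecJ L (IsCMField.complexConj L) (n + n) (IsCMField.complexConj_ne_one L) (cmPlaceOver L) (cmPlaceOver_smul L) _
            (gramD_gram_realDiagonal_entry_ne_zero L e dV hdV dW hdW hdV0 hdW0) (complexConj_imagUnit L) (imagUnit_ne_zero L) σ
            (cmPlaceOver_comap L) (gramD_eq_diagonal_cm L e dV hdV dW hdW) (J := hermD L e dV hdV dW hdW) rfl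
            (complexConj_smul_infinitePlace L) e₂P e₂Q
            ((((uFormGroup (Fin 2) (Fin 2)).expMem
                ⟨((s • Y : ↥(uFormGroup (Fin 2) (Fin 2)).lie.toSubmodule) : Matrix (Fin 2 ⊕ Fin 2) (Fin 2 ⊕ Fin 2) ℂ), (s • Y).2⟩ :
                UForm (Fin 2) (Fin 2)), (1 : UForm Unit Empty)) : Ginf (Fin 2) (Fin 2) Unit Empty)) : ℂˣ) : ℂ))
      (deriv (fun s : ℝ => ((etaD L e dV hdV dW hdW t
            (placeSecJ L (IsCMField.complexConj L) (n + n) (IsCMField.complexConj_ne_one L) (cmPlaceOver L) (cmPlaceOver_smul L) _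
            (gramD_gram_realDiagonal_entry_ne_zero L e dV hdV dW hdW hdV0 hdW0) (complexConj_imagUnit L) (imagUnit_ne_zero L) σ
            (cmPlaceOver_comap L) (gramD_eq_diagonal_cm L e dV hdV dW hdW) (J := hermD L e dV hdV dW hdW) rfl
            (complexConj_smul_infinitePlace L) e₂P e₂Q
            ((((uFormGroup (Fin 2) (Fin 2)).expMem
                ⟨((s • Y : ↥(uFormGroup (Fin 2) (Fin 2)).lie.toSubmodule) : Matrix (Fin 2 ⊕ Fin 2) (Fin 2 ⊕ Fin 2) ℂ), (s • Y).2⟩ :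
                UForm (Fin 2) (Fin 2)), (1 : UForm Unit Empty)) : Ginf (Fin 2) (Fin 2) Unit Empty)) : ℂˣ) : ℂ)) 0) 0 :=
    ((contDiffAt_coe_etaD_placeSecJ_expMem L e dV hdV hdV0 dW hdW hdW0 σ e₂P e₂Q t Y 0).differentiableAt (by simp)).hasDerivAt
  have hη0 : ((etaD L e dV hdV dW hdW t
            (placeSecJ L (IsCMField.complexConj L) (n + n) (IsCMField.complexConj_ne_one L) (cmPlaceOver L) (cmPlaceOver_smul L) _
            (gramD_gram_realDiagonal_entry_ne_zero L e dV hdV dW hdW hdV0 hdW0) (complexConj_imagUnit L) (imagUnit_ne_zero L) σ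
            (cmPlaceOver_comap L) (gramD_eq_diagonal_cm L e dV hdV dW hdW) (J := hermD L e dV hdV dW hdW) rfl
            (complexConj_smul_infinitePlace L) e₂P e₂Q
            ((((uFormGroup (Fin 2) (Fin 2)).expMem
                ⟨(((0 : ℝ) • Y : ↥(uFormGroup (Fin 2) (Fin 2)).lie.toSubmodule) : Matrix (Fin 2 ⊕ Fin 2) (Fin 2 ⊕ Fin 2) ℂ), ((0 : ℝ) • Y).2⟩ :
                UForm (Fin 2) (Fin 2)), (1 : UForm Unit Empty)) : Ginf (Fin 2) (Fin 2) Unit Empty)) : ℂˣ) : ℂ) = 1 := by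
    rw [hk0, map_one, map_one, Units.val_one]
  -- (2) the Folland leg through the pinned factorisation: `T′ := ℓ′ ∘ (· ⊠ Φ₂)` on the junction datum `weilRepPair`
  have hω := hasDerivAt_weilDatum_expMem_smul' (isArchWeilDatum_weilRepPair (Fin 2) (Fin 2) Unit Empty) weilRepPair_κ_hermitePi_zero
    ((ℓ'.comp (SchwartzMap.sumProdLeftCLM (𝕜 := ℂ) (E := ℝ) (ι₁ := DPIdx (Fin 2) (Fin 2) Unit Empty) Φ₂)).restrictScalars ℝ) Φ₁ Y
  have hω0 : ((weilRep (α := (Fin 2 × Unit) ⊕ (Fin 2 × Empty)) (β := (Fin 2 × Empty) ⊕ (Fin 2 × Unit))).comp (toBig (Fin 2) (Fin 2) Unit Empty))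
      ((((uFormGroup (Fin 2) (Fin 2)).expMem
                ⟨(((0 : ℝ) • Y : ↥(uFormGroup (Fin 2) (Fin 2)).lie.toSubmodule) : Matrix (Fin 2 ⊕ Fin 2) (Fin 2 ⊕ Fin 2) ℂ), ((0 : ℝ) • Y).2⟩ :
                UForm (Fin 2) (Fin 2)), (1 : UForm Unit Empty)) : Ginf (Fin 2) (Fin 2) Unit Empty) Φ₁ = Φ₁ := by
    rw [hk0, map_one, Module.End.one_apply]
  -- (3) the section along the curve IS the product `η(s) · T′(weilRepPair k(s) Φ₁)`
  have hfun : (fun s : ℝ => swSection L e dV hdV hdV0 dW hdW hdW0 sD (piSchwartzBruhatEquiv (Fp L) (Fin (n + n)) (a ⊗ₜ f))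
        (h * K2LiuArchOneParameterOrbitDefs.archEmb (Fp L) L (IsCMField.complexConj L) (n + n) (hermD L e dV hdV dW hdW)
          (placeSecJ L (IsCMField.complexConj L) (n + n) (IsCMField.complexConj_ne_one L) (cmPlaceOver L) (cmPlaceOver_smul L) _
            (gramD_gram_realDiagonal_entry_ne_zero L e dV hdV dW hdW hdV0 hdW0) (complexConj_imagUnit L) (imagUnit_ne_zero L) σ
            (cmPlaceOver_comap L) (gramD_eq_diagonal_cm L e dV hdV dW hdW) (J := hermD L e dV hdV dW hdW) rfl
            (complexConj_smul_infinitePlace L) e₂P e₂Q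
            ((((uFormGroup (Fin 2) (Fin 2)).expMem
                ⟨((s • Y : ↥(uFormGroup (Fin 2) (Fin 2)).lie.toSubmodule) : Matrix (Fin 2 ⊕ Fin 2) (Fin 2 ⊕ Fin 2) ℂ), (s • Y).2⟩ :
                UForm (Fin 2) (Fin 2)), (1 : UForm Unit Empty)) : Ginf (Fin 2) (Fin 2) Unit Empty)))) =
      fun s : ℝ => ((etaD L e dV hdV dW hdW t
            (placeSecJ L (IsCMField.complexConj L) (n + n) (IsCMField.complexConj_ne_one L) (cmPlaceOver L) (cmPlaceOver_smul L) _
            (gramD_gram_realDiagonal_entry_ne_zero L e dV hdV dW hdW hdV0 hdW0) (complexConj_imagUnit L) (imagUnit_ne_zero L) σ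
            (cmPlaceOver_comap L) (gramD_eq_diagonal_cm L e dV hdV dW hdW) (J := hermD L e dV hdV dW hdW) rfl
            (complexConj_smul_infinitePlace L) e₂P e₂Q
            ((((uFormGroup (Fin 2) (Fin 2)).expMem
                ⟨((s • Y : ↥(uFormGroup (Fin 2) (Fin 2)).lie.toSubmodule) : Matrix (Fin 2 ⊕ Fin 2) (Fin 2 ⊕ Fin 2) ℂ), (s • Y).2⟩ :
                UForm (Fin 2) (Fin 2)), (1 : UForm Unit Empty)) : Ginf (Fin 2) (Fin 2) Unit Empty)) : ℂˣ) : ℂ) *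
        ((ℓ'.comp (SchwartzMap.sumProdLeftCLM (𝕜 := ℂ) (E := ℝ) (ι₁ := DPIdx (Fin 2) (Fin 2) Unit Empty) Φ₂)).restrictScalars ℝ)
          (((weilRep (α := (Fin 2 × Unit) ⊕ (Fin 2 × Empty)) (β := (Fin 2 × Empty) ⊕ (Fin 2 × Unit))).comp (toBig (Fin 2) (Fin 2) Unit Empty))
            ((((uFormGroup (Fin 2) (Fin 2)).expMem
                ⟨((s • Y : ↥(uFormGroup (Fin 2) (Fin 2)).lie.toSubmodule) : Matrix (Fin 2 ⊕ Fin 2) (Fin 2 ⊕ Fin 2) ℂ), (s • Y).2⟩ :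
                UForm (Fin 2) (Fin 2)), (1 : UForm Unit Empty)) : Ginf (Fin 2) (Fin 2) Unit Empty) Φ₁) := by
    funext s
    rw [hℓ', ha, archSectionRepJ_placeSecJ_inl_tensorPi, ContinuousLinearMap.coe_restrictScalars', ContinuousLinearMap.comp_apply,
      sumProdLeftCLM_apply_eq_tensorPi]
  -- (4) product rule, and the value at `0` read back as `f_{a′ ⊗ f}(h)` through the same `ℓ′` at `u = 1`
  rw [hfun]
  have hprod := hη.mul hω
  rw [hη0, hω0, one_mul] at hprod
  refine hprod.congr_deriv ?_
  -- `f_{a′ ⊗ f}(h) = ℓ′(𝒥 a′)`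
  have h1 := hℓ' 1 (deriv (fun s : ℝ => ((etaD L e dV hdV dW hdW t
            (placeSecJ L (IsCMField.complexConj L) (n + n) (IsCMField.complexConj_ne_one L) (cmPlaceOver L) (cmPlaceOver_smul L) _
            (gramD_gram_realDiagonal_entry_ne_zero L e dV hdV dW hdW hdV0 hdW0) (complexConj_imagUnit L) (imagUnit_ne_zero L) σ
            (cmPlaceOver_comap L) (gramD_eq_diagonal_cm L e dV hdV dW hdW) (J := hermD L e dV hdV dW hdW) rfl
            (complexConj_smul_infinitePlace L) e₂P e₂Q
            ((((uFormGroup (Fin 2) (Fin 2)).expMem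
                ⟨((s • Y : ↥(uFormGroup (Fin 2) (Fin 2)).lie.toSubmodule) : Matrix (Fin 2 ⊕ Fin 2) (Fin 2 ⊕ Fin 2) ℂ), (s • Y).2⟩ :
                UForm (Fin 2) (Fin 2)), (1 : UForm Unit Empty)) : Ginf (Fin 2) (Fin 2) Unit Empty)) : ℂˣ) : ℂ)) 0 • a +
          ((((schwartzTransport
                  (scaledFrame (Fp L) (Fin (n + n))
                    (placeScale (n + n) fun v => sqrtAbs (signVec (cmPlaceOver L)
                      (fun k => Sum.elim (cmGramEntry L e dV hdV dW hdW) (-cmGramEntry L e dV hdV dW hdW) ((LocalSplitting.e₂ n).symm k))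
                      (imagUnit L) v))
                    (placeScale_ne_zero (n + n) (sqrtAbs_signVec_ne_zero (IsCMField.complexConj_ne_one L) (cmPlaceOver_smul L)
                      (complexConj_imagUnit L) (imagUnit_ne_zero L) (gramD_gram_realDiagonal_entry_ne_zero L e dV hdV dW hdW hdV0 hdW0))))).trans
                (schwartzTransport (reindexCLE (placeSplitEquiv (signSplit (signVec (cmPlaceOver L)
                      (fun k => Sum.elim (cmGramEntry L e dV hdV dW hdW) (-cmGramEntry L e dV hdV dW hdW) ((LocalSplitting.e₂ n).symm k))
                      (imagUnit L) σ)) σ)))).trans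
                (schwartzTransport (reindexCLE (Equiv.sumCongr
                  (unitJunctionIdx (PosIdx (signVec (cmPlaceOver L)
                      (fun k => Sum.elim (cmGramEntry L e dV hdV dW hdW) (-cmGramEntry L e dV hdV dW hdW) ((LocalSplitting.e₂ n).symm k))
                      (imagUnit L) σ)) (NegIdx (signVec (cmPlaceOver L)
                      (fun k => Sum.elim (cmGramEntry L e dV hdV dW hdW) (-cmGramEntry L e dV hdV dW hdW) ((LocalSplitting.e₂ n).symm k))
                      (imagUnit L) σ))).symm
                  (Equiv.refl (Fin (n + n) × {v : {v : InfinitePlace (Fp L) // v.IsReal} // v ≠ σ})))))).trans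
                (schwartzTransport (reindexCLE (Equiv.sumCongr
                  (dpIdxCongr (PosIdx (signVec (cmPlaceOver L)
                      (fun k => Sum.elim (cmGramEntry L e dV hdV dW hdW) (-cmGramEntry L e dV hdV dW hdW) ((LocalSplitting.e₂ n).symm k))
                      (imagUnit L) σ)) (NegIdx (signVec (cmPlaceOver L)
                      (fun k => Sum.elim (cmGramEntry L e dV hdV dW hdW) (-cmGramEntry L e dV hdV dW hdW) ((LocalSplitting.e₂ n).symm k))
                      (imagUnit L) σ))
                    Unit Empty (Fin 2) (Fin 2) Unit Empty e₂P e₂Q (Equiv.refl Unit) (Equiv.refl Empty)).symm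
                  (Equiv.refl (Fin (n + n) × {v : {v : InfinitePlace (Fp L) // v.IsReal} // v ≠ σ})))))).symm
            (tensorPi (∑ i, (((u22AdaptedBasis.repr Y) i : ℝ) : ℂ) •
              (K2LiuWeilDatumSmoothU22.u22LetterOp Unit Empty (⟨-(Fintype.card Empty : ℤ), -(Fintype.card Unit : ℤ), -(Fintype.card (Fin 2) : ℤ), -(Fintype.card (Fin 2) : ℤ)⟩ : VacExponents) (u22FrameK i) (u22Kind i)).pre
                ((K2LiuWeilDatumSmoothU22.u22LetterOp Unit Empty (⟨-(Fintype.card Empty : ℤ), -(Fintype.card Unit : ℤ), -(Fintype.card (Fin 2) : ℤ), -(Fintype.card (Fin 2) : ℤ)⟩ : VacExponents) (u22FrameK i) (u22Kind i)).gen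
                  ((K2LiuWeilDatumSmoothU22.u22LetterOp Unit Empty (⟨-(Fintype.card Empty : ℤ), -(Fintype.card Unit : ℤ), -(Fintype.card (Fin 2) : ℤ), -(Fintype.card (Fin 2) : ℤ)⟩ : VacExponents) (u22FrameK i) (u22Kind i)).post Φ₁))) Φ₂))
  rw [map_one, map_one, mul_one, map_one, map_one, Units.val_one, one_mul, Module.End.one_apply, map_add, map_smul,
    ContinuousLinearEquiv.apply_symm_apply, ha, map_add, map_smul, smul_eq_mul] at h1
  rw [h1]
  simp only [ContinuousLinearMap.coe_restrictScalars', ContinuousLinearMap.comp_apply, sumProdLeftCLM_apply_eq_tensorPi]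

end Summit.HodgeConjecture.HodgeConjecture.Cruxes.HLiu418.K2LiuSwSectionArchOrbit

end
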